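import Summits.QuantumFields.YangMills.Theorems.BalabanUVNodesPortS1FlatKernel
import Summits.QuantumFields.YangMills.Theorems.BalabanUVNodesPortS1HalvesDefs

/-!
# NODE O port PT-A — THE PORTER's `h` IS PRINT's `h`: `LQ̃ ∘ h = id` on 𝔰𝔲(2)-valued coarse fields («LQ̃h = I», p.267) for `h = hopLinGraph Vk` (✓`…PortS1HalvesDefs`) UNDER the letter
# `RecordB0BlockInvertible Vk` and 𝔰𝔲(2)-valuedness of `LQ̃(Vk)`; UNCONDITIONALLY at the flat background (`recordLQt_one_hopLinGraph`, by `…FlatLetter` ∕ `…FlatKernel`)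

Cell `ym-nodeO-ideate`, porter seat `ymgap-nodeO-port-PTA-1` (gen 4); `--supports stmt-QuantumFields-27930` (helper; correctness receipt for the porter's letter `hopLinGraph` that fixes ed.15's `hopLin` parameter in
`phiLZ`).  [I] = [Balaban1987RG1].
* §1 `hopLinGraph_apply_b0`, `hopLinGraph_apply_of_not_mem`, `hopLinGraph_eq_sumElim` (the `blkToFluct` picture), ★ `recordLQtMat_mulVec_hopLinGraph` (`recordLQtMat Vk · h D = coarseCoord D` under the letter).
* §2 `su2Coord_sub`, ★★ `recordLQt_hopLinGraph` (`LQ̃(Vk) (h D) = D`), ★★ `recordLQt_one_hopLinGraph` (flat, unconditional).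

HONEST FRAMING.  Linear algebra at the record's names; NOTHING of Bałaban asserted∕ported∕discharged; 27930 OPEN; K0⁷∕K-Ax OPEN; NODE O 0∕1; COUNT 8∕28 · K 1∕4 UNMOVED; finite `𝕋⁴_{L^K}` at fixed ε —
NOT continuum ∕ OS ∕ Clay; **the Yang–Mills mass gap is NOT proved by any of this.**  No `sorry`, no `def`, no `instance`; standard axioms.
-/

noncomputable section

open scoped BigOperators Matrix.Norms.L2Operator Topology

namespace Summit.QuantumFields.YangMills.Theorems.BalabanUVNodesPortS1

open Summit.QuantumFields.YangMills.Theorems.K0RecordFormatNames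
open Literature.MathematicalPhysics.QuantumFieldTheory.Balaban1983to89
open Literature.MathematicalPhysics.QuantumFieldTheory.Balaban1983to89.Node00
open Literature.MathematicalPhysics.QuantumFieldTheory.Balaban1983to89.T4Continuum (T4Family)
open Literature.MathematicalPhysics.QuantumFieldTheory.Balaban1983to89.T4AdjointCovarianceUnitary (lieSU mem_lieSU_iff)
open _root_.Matrix

variable (F : T4Family)

/-! ## §1  `h` in the `blkToFluct` picture and `LQ̃ · h = id` in coordinates -/

open Classical in
/-- `h D` on a central-bond coordinate `(b₀(c), j)` is `(A₁⁻¹ · coarseCoord D)(c, j)` (standing range: `b₀` injective). [cite: Balaban1987RG1, p.267 («(hB)(b₀(c)) = h(c)B(c)»)] -/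
theorem hopLinGraph_apply_b0 (k K : ℕ) (hk : k + 1 ≤ (F.P K).m + (F.P K).K) (Vk : GaugeField (F.P K) k (SU 2)) (D : PBond (F.P K) (k + 1) → MatA 2)
    (c : PBond (F.P K) (k + 1)) (j : Fin 3) :
    hopLinGraph F k K Vk D (recordB0 F k K c, j) = ((recordLQtB0 F k K Vk)⁻¹ *ᵥ coarseCoord F k K D) (c, j) := by
  have hmem : (recordB0 F k K c, j).1 ∈ Set.range (recordB0 F k K) := ⟨c, rfl⟩
  have hch : hmem.choose = c := BlockAveragingHaarAC.centralBond_injective hk hmem.choose_spec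
  show (if h : (recordB0 F k K c, j).1 ∈ Set.range (recordB0 F k K) then ((recordLQtB0 F k K Vk)⁻¹ *ᵥ coarseCoord F k K D) (h.choose, j) else 0) = _
  rw [dif_pos hmem, hch]

open Classical in
/-- `h D` vanishes off the central-bond coordinates. [cite: Balaban1987RG1, p.267 (extension by zero)] -/
theorem hopLinGraph_apply_of_not_mem (k K : ℕ) (Vk : GaugeField (F.P K) k (SU 2)) (D : PBond (F.P K) (k + 1) → MatA 2) (i : FluctIdx F k K)
    (hi : i.1 ∉ Set.range (recordB0 F k K)) : hopLinGraph F k K Vk D i = 0 := by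
  show (if h : i.1 ∈ Set.range (recordB0 F k K) then ((recordLQtB0 F k K Vk)⁻¹ *ᵥ coarseCoord F k K D) (h.choose, i.2) else 0) = 0
  rw [dif_neg hi]

open Classical in
/-- `h D` in the block picture: `h D = [A₁⁻¹·coarseCoord D ; 0] ∘ blkToFluct⁻¹`. [cite: Balaban1987RG1, p.267 (bookkeeping)] -/
theorem hopLinGraph_eq_sumElim (k K : ℕ) (hk : k + 1 ≤ (F.P K).m + (F.P K).K) (Vk : GaugeField (F.P K) k (SU 2)) (D : PBond (F.P K) (k + 1) → MatA 2) :
    hopLinGraph F k K Vk D = Sum.elim ((recordLQtB0 F k K Vk)⁻¹ *ᵥ coarseCoord F k K D) 0 ∘ ⇑(Equiv.ofBijective _ (blkToFluct_bijective F k K hk)).symm := by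
  set e := Equiv.ofBijective _ (blkToFluct_bijective F k K hk) with he
  funext i
  obtain ⟨s, rfl⟩ := e.surjective i
  rw [Function.comp_apply, Equiv.symm_apply_apply]
  rcases s with ⟨c, j⟩ | ⟨i, hi⟩
  · exact hopLinGraph_apply_b0 F k K hk Vk D c j
  · exact hopLinGraph_apply_of_not_mem F k K Vk D i hi

open Classical in
/-- ★ **`LQ̃ · h = id` IN COORDINATES**: `recordLQtMat Vk *ᵥ (h D) = coarseCoord D` UNDER the letter. [cite: Balaban1987RG1, p.267 («LQ̃h = I»)] -/
theorem recordLQtMat_mulVec_hopLinGraph (k K : ℕ) (hk : k + 1 ≤ (F.P K).m + (F.P K).K) (Vk : GaugeField (F.P K) k (SU 2)) (hA : RecordB0BlockInvertible F k K Vk)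
    (D : PBond (F.P K) (k + 1) → MatA 2) :
    recordLQtMat F k K Vk *ᵥ hopLinGraph F k K Vk D = coarseCoord F k K D := by
  set e : CoarseIdx F k K ⊕ NonB0Idx F k K ≃ FluctIdx F k K := Equiv.ofBijective _ (blkToFluct_bijective F k K hk) with he
  rw [hopLinGraph_eq_sumElim F k K hk Vk D]
  have h1 : recordLQtMat F k K Vk *ᵥ (Sum.elim ((recordLQtB0 F k K Vk)⁻¹ *ᵥ coarseCoord F k K D) 0 ∘ ⇑e.symm) =
      (recordLQtMat F k K Vk).submatrix _root_.id ⇑e *ᵥ Sum.elim ((recordLQtB0 F k K Vk)⁻¹ *ᵥ coarseCoord F k K D) 0 := by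
    rw [Matrix.submatrix_mulVec_equiv]; rfl
  have hMblk : recordLQtBlk F k K Vk = (recordLQtMat F k K Vk).submatrix _root_.id ⇑e := recordLQtBlk_eq_submatrix F k K Vk
  rw [h1, ← hMblk, recordLQtBlk, Matrix.fromCols_mulVec_sumElim, Matrix.mulVec_zero, add_zero, Matrix.mulVec_mulVec, Matrix.mul_nonsing_inv _ hA, Matrix.one_mulVec]

/-! ## §2  `LQ̃ (h D) = D` -/

/-- `su2Coord` of a difference. [folklore] -/
theorem su2Coord_sub (M N : MatA 2) (j : Fin 3) : su2Coord (M - N) j = su2Coord M j - su2Coord N j := by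
  fin_cases j <;> simp [su2Coord]

open Classical in
/-- ★★ **THE PORTER's `h` IS PRINT's `h`**: `LQ̃(Vk) (h D) = D` for every 𝔰𝔲(2)-valued coarse field `D`, UNDER the letter `RecordB0BlockInvertible Vk` and 𝔰𝔲(2)-valuedness of `LQ̃(Vk)`.
[cite: Balaban1987RG1, p.267 («LQ̃h = I», «h is uniquely defined»)] -/
theorem recordLQt_hopLinGraph (k K : ℕ) (hk : k + 1 ≤ (F.P K).m + (F.P K).K) (Vk : GaugeField (F.P K) k (SU 2)) (hA : RecordB0BlockInvertible F k K Vk)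
    (hsu : ∀ (x : FluctIdx F k K → ℝ) (c : PBond (F.P K) (k + 1)), recordLQt F k K Vk x c ∈ lieSU (Fin 2))
    (D : PBond (F.P K) (k + 1) → MatA 2) (hD : ∀ c, D c ∈ lieSU (Fin 2)) :
    recordLQt F k K Vk (hopLinGraph F k K Vk D) = D := by
  funext c
  have hcoord : ∀ j, su2Coord (recordLQt F k K Vk (hopLinGraph F k K Vk D) c) j = su2Coord (D c) j := by
    intro j
    have h := congrFun (recordLQtMat_mulVec_hopLinGraph F k K hk Vk hA D) (c, j)
    rwa [recordLQtMat_mulVec] at h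
  have h0 := eq_zero_of_mem_lieSU_of_su2Coord (Submodule.sub_mem _ (hsu _ c) (hD c)) fun j => by rw [su2Coord_sub, hcoord j, sub_self]
  exact sub_eq_zero.mp h0

/-- ★★ **AT THE FLAT BACKGROUND, UNCONDITIONALLY**: `LQ̃(1) (h D) = D` for 𝔰𝔲(2)-valued `D` (the letter and 𝔰𝔲(2)-valuedness are theorems at `Vk = 1`). [cite: Balaban1987RG1, p.267] -/
theorem recordLQt_one_hopLinGraph (k K : ℕ) (hk : k + 1 ≤ (F.P K).m + (F.P K).K) (D : PBond (F.P K) (k + 1) → MatA 2) (hD : ∀ c, D c ∈ lieSU (Fin 2)) :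
    recordLQt F k K (1 : GaugeField (F.P K) k (SU 2)) (hopLinGraph F k K 1 D) = D :=
  recordLQt_hopLinGraph F k K hk 1 (recordB0BlockInvertible_one F k K hk) (recordLQt_one_mem_lieSU F k K) D hD

end Summit.QuantumFields.YangMills.Theorems.BalabanUVNodesPortS1

end
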